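import Mathlib
import HarnessLib
import Literature.Probability.LatticeModels.RandomClusterFKG
import Literature.Probability.LatticeModels.TwoPointSupNormMonotone
import Literature.Probability.LatticeModels.IsingPlusEdwardsSokal
import Literature.Probability.LatticeModels.GKSInequalities
import Literature.Probability.LatticeModels.SharpnessProofs
import Literature.Probability.LatticeModels.MessagerMiracleSole
import Literature.Probability.LatticeModels.CriticalFKIsingBoxCrossingLower
import Literature.Probability.LatticeModels.ThermodynamicLimit
import Summits.CriticalPhenomena.Ising3DConformalLimit.Theses.ArmDressing
import Summits.CriticalPhenomena.Ising3DConformalLimit.Theorems.ArmDressingEvenPatternDecouplingEvenPatternLowerGKS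
import Summits.CriticalPhenomena.Ising3DConformalLimit.Theorems.ArmDressingEvenPatternDecouplingArmsUpperWired
import Summits.CriticalPhenomena.Ising3DConformalLimit.Theorems.ArmDressingEvenPatternDecouplingKestenArmMixingGlue

/-!
# Crux `EvenPatternDecoupling` (stmt-CriticalPhenomena-16133), line `registered`: non-degeneracy of the even pattern
# given the arms from one-arm hyperscaling at every ratio [HS]

Proved in the line skeleton (revision 6, lead c1; landed here unchanged): [HS] + the landed Griffiths lower bound
`stub_evenPatternLowerGKS` (p157913) + the landed wired-arm upper bound `stub_armsUpperWired` (p158571) give, for every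
even `n = k + k` and points `z` in the disjoint outer balls, `p > 0` with `p ≤ Pr[EVEN(z^δ)] / Pr[all point arms]`
frequently as `δ → 0⁺` (birth stub 3 of the line): pair `z (castAdd i)` with `z (natAdd i)`, common slack `4a`,
`N := ⌊a/δ⌋₊`, ratio `lam := ⌈6D/a⌉₊ + 7`; each pair's two-point function dominates the axial one at distance `lam N`
(Messager–Miracle-Solé), which [HS] bounds below by `κ θ_N²`; hence `Pr[EVEN] ≥ κ^k θ_N^{2k} ≥ κ^k Pr[arms]`.
-/

namespace Summit.CriticalPhenomena.Ising3DConformalLimit.Theorems.EvenPatternDecoupling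

open scoped Topology
open Filter Set Metric
open Literature.Probability.LatticeModels Literature.Barriers.CriticalPhenomena

/-- Coordinates of lattice approximations differ by at most `dist/δ + 1`. -/
theorem abs_latticeApprox_sub_le {δ : ℝ} (hδ : 0 < δ) (p q : EuclideanSpace ℝ (Fin 3)) (i : Fin 3) :
    |((Literature.Probability.LatticeModels.latticeApprox δ p i -
        Literature.Probability.LatticeModels.latticeApprox δ q i : ℤ) : ℝ)| ≤ dist p q / δ + 1 := by
  simp only [Literature.Probability.LatticeModels.latticeApprox_apply, Int.cast_sub]
  have hcoord : |p i - q i| ≤ dist p q := by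
    rw [EuclideanSpace.dist_eq]
    have h1 : (p i - q i) ^ 2 ≤ ∑ j, dist (p j) (q j) ^ 2 := by
      have : dist (p i) (q i) ^ 2 ≤ ∑ j, dist (p j) (q j) ^ 2 :=
        Finset.single_le_sum (f := fun j => dist (p j) (q j) ^ 2) (fun j _ => by positivity)
          (Finset.mem_univ i)
      rw [Real.dist_eq] at this
      simpa only [sq_abs] using this
    calc |p i - q i| = Real.sqrt ((p i - q i) ^ 2) := (Real.sqrt_sq_eq_abs _).symm
      _ ≤ Real.sqrt (∑ j, dist (p j) (q j) ^ 2) := Real.sqrt_le_sqrt h1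
  have hu : (⌊p i / δ⌋ : ℝ) ≤ p i / δ := Int.floor_le _
  have hu' : p i / δ < ⌊p i / δ⌋ + 1 := Int.lt_floor_add_one _
  have hv : (⌊q i / δ⌋ : ℝ) ≤ q i / δ := Int.floor_le _
  have hv' : q i / δ < ⌊q i / δ⌋ + 1 := Int.lt_floor_add_one _
  have hdiv : |p i / δ - q i / δ| ≤ dist p q / δ := by
    rw [← sub_div, abs_div, abs_of_pos hδ]
    exact div_le_div_of_nonneg_right hcoord hδ.le
  have h3 := abs_le.1 hdiv
  rw [abs_le]
  constructor <;> linarith [h3.1, h3.2]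

/-- Sup norm of an axis point. -/
theorem le_supNorm_single (m : ℕ) :
    m ≤ Literature.Probability.LatticeModels.Site.supNorm (Pi.single (0 : Fin 3) (m : ℤ)) := by
  unfold Literature.Probability.LatticeModels.Site.supNorm
  have h := Finset.le_sup (f := fun i : Fin 3 => ((Pi.single (0 : Fin 3) (m : ℤ) : Fin 3 → ℤ) i).natAbs)
    (Finset.mem_univ (0 : Fin 3))
  simpa using h


/-- Arithmetic of the scales: `3 (⌈D/δ⌉₊ + 2) ≤ lam · N` once `lam ≥ 6D/a + 7`, `N ≥ a/δ - 1`, `δ ≤ a/3`. -/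
theorem three_mul_ceil_le {a D δ : ℝ} {lam N : ℕ} (ha : 0 < a) (hδ : 0 < δ) (hD0 : 0 ≤ D)
    (hδa : δ ≤ a / 3) (hlamR : 6 * D / a + 7 ≤ (lam : ℝ)) (hN : a / δ - 1 ≤ (N : ℝ)) :
    3 * (⌈D / δ⌉₊ + 2) ≤ lam * N := by
  have haδ : 3 ≤ a / δ := by rw [le_div_iff₀ hδ]; linarith
  have hkey : (3 * (⌈D / δ⌉₊ + 2) : ℝ) ≤ (lam : ℝ) * N := by
    have h1 : (⌈D / δ⌉₊ : ℝ) ≤ D / δ + 1 := (Nat.ceil_lt_add_one (div_nonneg hD0 hδ.le)).le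
    have h2 : a / (2 * δ) ≤ (N : ℝ) := by
      have : a / (2 * δ) = a / δ / 2 := by field_simp
      rw [this]; linarith
    have h3 : (6 * D / a + 7) * (a / (2 * δ)) ≤ (lam : ℝ) * N :=
      mul_le_mul hlamR h2 (by positivity) (by positivity)
    have h4 : (6 * D / a + 7) * (a / (2 * δ)) = 3 * (D / δ) + 7 / 2 * (a / δ) := by
      field_simp
      ring
    rw [h4] at h3
    nlinarith [h1, h3, haδ]
  exact_mod_cast hkey

/-- Sup norm of a difference of lattice approximations of points at distance `≤ D`. -/
theorem supNorm_latticeApprox_sub_le {δ D : ℝ} (hδ : 0 < δ) {p q : EuclideanSpace ℝ (Fin 3)}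
    (hpq : dist p q ≤ D) :
    Literature.Probability.LatticeModels.Site.supNorm
        (Literature.Probability.LatticeModels.latticeApprox δ p -
          Literature.Probability.LatticeModels.latticeApprox δ q) ≤ ⌈D / δ⌉₊ + 2 := by
  rw [Literature.Probability.LatticeModels.Site.supNorm_le_iff]
  intro j
  have h := abs_latticeApprox_sub_le hδ p q j
  have hdist : dist p q / δ + 1 ≤ D / δ + 1 := by
    have := div_le_div_of_nonneg_right hpq hδ.le; linarith
  have hreal : |(((Literature.Probability.LatticeModels.latticeApprox δ p -
      Literature.Probability.LatticeModels.latticeApprox δ q) j : ℤ) : ℝ)| ≤ (⌈D / δ⌉₊ + 2 : ℕ) := by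
    rw [Pi.sub_apply]
    refine (h.trans hdist).trans ?_
    push_cast
    linarith [Nat.le_ceil (D / δ)]
  have hint : |((Literature.Probability.LatticeModels.latticeApprox δ p -
      Literature.Probability.LatticeModels.latticeApprox δ q) j : ℤ)| ≤ ((⌈D / δ⌉₊ + 2 : ℕ) : ℤ) := by
    have : ((|((Literature.Probability.LatticeModels.latticeApprox δ p -
        Literature.Probability.LatticeModels.latticeApprox δ q) j : ℤ)| : ℤ) : ℝ) ≤ (((⌈D / δ⌉₊ + 2 : ℕ) : ℤ) : ℝ) := by
      rw [Int.cast_abs]; exact_mod_cast hreal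
    exact_mod_cast this
  rw [← Int.ofNat_le, Int.natCast_natAbs]
  exact hint

/-- The MMS step: a lattice pair difference of sup norm `≤ (lam N)/3` has a larger critical two-point function
than the axis point `lam N e₀` (`twoPointPlus_le_of_mul_supNorm_le`). -/
theorem criticalTwoPoint_single_le {x : Literature.Probability.LatticeModels.Site 3} {lam N : ℕ}
    (h : 3 * Literature.Probability.LatticeModels.Site.supNorm x ≤ lam * N) :
    Literature.Probability.LatticeModels.criticalTwoPoint 3 (Pi.single 0 ((lam * N : ℕ) : ℤ)) ≤
      Literature.Probability.LatticeModels.criticalTwoPoint 3 x := by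
  unfold Literature.Probability.LatticeModels.criticalTwoPoint
  refine Literature.Probability.LatticeModels.twoPointPlus_le_of_mul_supNorm_le
    (Literature.Probability.LatticeModels.criticalBeta_nonneg (d := 3)) ?_
  exact h.trans (le_supNorm_single (lam * N))

/-- A common slack: finitely many points of open balls have closed `4a`-balls inside, for some `a > 0`. -/
theorem exists_common_slack {ι X : Type*} [Finite ι] [PseudoMetricSpace X] (c z : ι → X) (r : ι → ℝ)
    (hz : ∀ j, z j ∈ ball (c j) (r j)) : ∃ a : ℝ, 0 < a ∧ ∀ j, closedBall (z j) (4 * a) ⊆ ball (c j) (r j) := by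
  have hev : ∀ᶠ a in 𝓝[>] (0:ℝ), 0 < a ∧ ∀ j, 4 * a < r j - dist (z j) (c j) := by
    refine Filter.Eventually.and self_mem_nhdsWithin (eventually_all.2 fun j => ?_)
    have hgap : 0 < r j - dist (z j) (c j) := sub_pos.2 (mem_ball.1 (hz j))
    have hj : ∀ᶠ a in 𝓝 (0:ℝ), a < (r j - dist (z j) (c j)) / 4 := Iio_mem_nhds (by positivity)
    exact (hj.filter_mono nhdsWithin_le_nhds).mono fun a h => by linarith
  obtain ⟨a, ha, h⟩ := hev.exists
  refine ⟨a, ha, fun j x hx => ?_⟩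
  rw [mem_closedBall] at hx
  rw [mem_ball]
  calc dist x (c j) ≤ dist x (z j) + dist (z j) (c j) := dist_triangle _ _ _
    _ < r j := by linarith [h j]

/-- Points chosen in pairwise disjoint closed balls are pairwise distinct. -/
theorem injective_of_mem_disjoint_balls {ι X : Type*} [PseudoMetricSpace X] {c z : ι → X} {r : ι → ℝ}
    (hd : ∀ j k, j ≠ k → Disjoint (closedBall (c j) (r j)) (closedBall (c k) (r k)))
    (hz : ∀ j, z j ∈ ball (c j) (r j)) : Function.Injective z := by
  intro i j hij
  by_contra hne
  have h1 : z i ∈ closedBall (c i) (r i) := ball_subset_closedBall (hz i)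
  have h2 : z j ∈ closedBall (c j) (r j) := ball_subset_closedBall (hz j)
  rw [hij] at h1
  exact Set.disjoint_left.1 (hd i j hne) h1 h2

/-- The final real-arithmetic step: `A ≤ t^{k+k}`, `(κ t²)^k ≤ E`, `A > 0` give `κ^k ≤ E / A`. -/
theorem pow_le_div_of_bounds {E A t κ : ℝ} {k : ℕ} (hκ : 0 ≤ κ) (hA0 : 0 < A) (hA : A ≤ t ^ (k + k))
    (hE : (κ * t ^ 2) ^ k ≤ E) : κ ^ k ≤ E / A := by
  rw [le_div_iff₀ hA0]
  calc κ ^ k * A ≤ κ ^ k * t ^ (k + k) := mul_le_mul_of_nonneg_left hA (pow_nonneg hκ k)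
    _ = (κ * t ^ 2) ^ k := by rw [mul_pow, ← pow_mul, two_mul]
    _ ≤ E := hE

/-- Products: `(κ θ²)^k ≤ ∏ G_i` when each `G_i ≥ κ θ² ≥ 0`; and `κ^k θ^{k+k} = (κ θ²)^k`. -/
theorem pow_le_prod_of_le {k : ℕ} {u : ℝ} (hu : 0 ≤ u) (G : Fin k → ℝ) (h : ∀ i, u ≤ G i) :
    u ^ k ≤ ∏ i, G i := by
  have h' := Finset.prod_le_prod (s := Finset.univ) (f := fun _ : Fin k => u) (g := G)
    (fun i _ => hu) (fun i _ => h i)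
  simpa [Finset.prod_const] using h'

set_option linter.unusedVariables false in
open Literature.Probability.LatticeModels Literature.Probability.Percolation
  Literature.Barriers.CriticalPhenomena in
/-- **Birth stub 3 DERIVED (revision 6): [HS] + [GKS] + [ARM] ⇒ non-degeneracy of the even pattern given the
arms, for every even `n`.** For `n = k + k` points `z` (pairwise distinct: they lie in disjoint balls) pair
`z (castAdd i)` with `z (natAdd i)`. With `4a` a common slack of the points in their balls and `N := ⌊a/δ⌋₊`:
[ARM] bounds the joint arm probability by `θ¹_N ^ n` and gives its positivity; [GKS] bounds `Pr[EVEN(z^δ)]`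
below by the product over the `k` pairs of critical two-point functions; each lattice pair difference has sup
norm `≤ ⌈D/δ⌉₊ + 2`, so by the Messager–Miracle-Solé comparison (`twoPointPlus_le_of_mul_supNorm_le`) its
two-point function dominates the axial one at distance `lam · N`, `lam := ⌈6D/a⌉₊ + 7`, which [HS] bounds below
by `κ θ¹_N ²`; hence `Pr[EVEN] ≥ κ^k θ¹_N^{2k} ≥ κ^k Pr[arms]` eventually in `δ`. -/
-- the header below is the registered stub signature (whitespace-compressed)
theorem evenPatternNondegenerate_of_HS : (open Literature.Probability.LatticeModels Literature.Barriers.CriticalPhenomena in ∀ lam : ℕ, 1 ≤ lam→∃ κ : ℝ, 0 < κ ∧ ∃ N₀ : ℕ, ∀ N : ℕ, N₀ ≤ N→κ * (thetaWiredBox 3 (fkIsingParam (criticalBeta 3)) 2 N) ^ 2 ≤ criticalTwoPoint 3 (Pi.single 0 ((lam * N : ℕ) : ℤ)))→(open Literature.Probability.LatticeModels Literature.Probability.Percolation Literature.Barriers.CriticalPhenomena Filter Topology in let E3:=EuclideanSpace ℝ (Fin 3); let μ : (L : ℕ)→MeasureTheory.Measure (BondConfig (BoxV 3 L)):=fun L=>rcMeasure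 (boxGraph 3 L) (fkIsingParam (criticalBeta 3)) 2 (boxBoundary 3 L); let PrL : (m : ℕ)→(Fin m→Set (Site 3))→Set (Fin m→Fin m→Prop)→ℕ→ℝ:=fun _ K R L=>(μ L).real {ω | (fun i j=>∃ x y : BoxV 3 L, x.1 ∈ K i ∧ y.1 ∈ K j ∧ (openGraph ω).Reachable x y) ∈ R}; let Pr : (m : ℕ)→(Fin m→Set (Site 3))→Set (Fin m→Fin m→Prop)→ℝ:=fun m K R=>limUnder atTop (PrL m K R); let mesh : ℝ→Site 3→E3:=fun δ z=>WithLp.toLp 2 fun i : Fin 3=>δ * (z i : ℝ); let disc : ℝ→Set E3→Set (Site 3):=fun δ A=>{x | mesh δ x ∈ A}; let EVEN : (n : ℕ)→Set (Fin n→Fin n→Prop):=fun n=>{R | ∀ i, Even ({j : Fin n | R i j}.ncard)}; let EVEN2 : (n : ℕ)→Set (Fin (n + n)→Fin (n + n)→Prop):=fun n=>{R | ∀ i : Fin n, Even ({j : Fin n | R (Fin.castAdd n i) (Fin.castAdd n j)}.ncard)}; let CROSS : (n : ℕ)→Set (Fin (n + n)→Fin (n + n)→Prop):=fun n=>{R |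 ∀ i : Fin n, R (Fin.castAdd n i) (Fin.natAdd n i)}; let pts : (n : ℕ)→ℝ→(Fin n→E3)→(Fin n→Set (Site 3)):=fun _ δ z j=>{latticeApprox δ (z j)}; let fam : (n : ℕ)→ℝ→(Fin n→Set E3)→(Fin n→Set E3)→(Fin (n + n)→Set (Site 3)):=fun _ δ A B=>Fin.append (fun j=>disc δ (A j)) (fun j=>disc δ (B j)); ∀ (n : ℕ), 2 ≤ n→Even n→∀ (c : Fin n→E3) (r : Fin n→ℝ), (∀ j, 0 < r j)→(∀ j k, j ≠ k→Disjoint (Metric.closedBall (c j) (r j)) (Metric.closedBall (c k) (r k)))→∀ z : Fin n→E3, (∀ j, z j ∈ Metric.ball (c j) (r j))→∃ p : ℝ, 0 < p ∧ ∃ᶠ δ in 𝓝[>] 0, p ≤ Pr n (pts n δ z) (EVEN n) / Pr (n + n) (Fin.append (pts n δ z) (fun j=>disc δ (Metric.ball (c j) (r j))ᶜ)) (CROSS n)) := by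
  intro hHS E3 μ PrL Pr mesh disc EVEN EVEN2 CROSS pts fam n hn heven c r hr hdisj z hz
  obtain ⟨k, rfl⟩ := heven
  obtain ⟨a, ha, hsub⟩ := exists_common_slack c z r hz
  have hinj : Function.Injective z := injective_of_mem_disjoint_balls hdisj hz
  -- the total pair distance `D` and the ratio `lam`
  obtain ⟨D, hD0, hDi⟩ : ∃ D : ℝ, 0 ≤ D ∧ ∀ i : Fin k, dist (z (Fin.natAdd k i)) (z (Fin.castAdd k i)) ≤ D :=
    ⟨∑ i : Fin k, dist (z (Fin.natAdd k i)) (z (Fin.castAdd k i)), Finset.sum_nonneg fun i _ => dist_nonneg,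
      fun i => Finset.single_le_sum (f := fun i => dist (z (Fin.natAdd k i)) (z (Fin.castAdd k i)))
        (fun i _ => dist_nonneg) (Finset.mem_univ i)⟩
  obtain ⟨lam, hlam1, hlamR⟩ : ∃ lam : ℕ, 1 ≤ lam ∧ 6 * D / a + 7 ≤ (lam : ℝ) :=
    ⟨⌈6 * D / a⌉₊ + 7, by omega, by push_cast; linarith [Nat.le_ceil (6 * D / a)]⟩
  obtain ⟨κ, hκ, N₀, hHSN⟩ := hHS lam hlam1
  refine ⟨κ ^ k, pow_pos hκ k, ?_⟩
  -- eventualities in `δ`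
  have hpos : ∀ᶠ δ in 𝓝[>] (0:ℝ), 0 < δ := self_mem_nhdsWithin
  have hsmall : ∀ᶠ δ in 𝓝[>] (0:ℝ), δ ≤ a / 3 :=
    (eventually_le_nhds (by positivity : (0:ℝ) < a / 3)).filter_mono nhdsWithin_le_nhds
  have hN₀ : ∀ᶠ δ in 𝓝[>] (0:ℝ), N₀ ≤ ⌊a / δ⌋₊ := (tendsto_floor_div_nhdsGT ha).eventually_ge_atTop N₀
  apply Filter.Eventually.frequently
  filter_upwards [Summit.CriticalPhenomena.Ising3DConformalLimit.Theorems.EvenPatternDecoupling.stub_evenPatternLowerGKS k z hinj, Summit.CriticalPhenomena.Ising3DConformalLimit.Theorems.EvenPatternDecoupling.stub_armsUpperWired (k + k) c r z a ha hdisj hsub, hpos, hsmall, hN₀]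
    with δ hG hA hδ hδs hδN
  have hNR : a / δ - 1 ≤ ((⌊a / δ⌋₊ : ℕ) : ℝ) := by
    have := Nat.lt_floor_add_one (a / δ); linarith
  have hθ0 : 0 ≤ thetaWiredBox 3 (fkIsingParam (criticalBeta 3)) 2 ⌊a / δ⌋₊ := MeasureTheory.measureReal_nonneg
  -- (1) each pair's two-point function dominates `κ θ²`
  have hpair : ∀ i : Fin k, κ * thetaWiredBox 3 (fkIsingParam (criticalBeta 3)) 2 ⌊a / δ⌋₊ ^ 2 ≤
      criticalTwoPoint 3 (latticeApprox δ (z (Fin.natAdd k i)) - latticeApprox δ (z (Fin.castAdd k i))) :=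
    fun i => (hHSN _ hδN).trans (criticalTwoPoint_single_le
      ((Nat.mul_le_mul_left 3 (supNorm_latticeApprox_sub_le hδ (hDi i))).trans
        (three_mul_ceil_le ha hδ hD0 hδs hlamR hNR)))
  -- (2) product over the pairs
  have hprod := pow_le_prod_of_le (mul_nonneg hκ.le (pow_nonneg hθ0 2)) _ hpair
  -- (3) the arm probability is positive ([ARM]) and bounded by `θ ^ (k+k)`
  obtain ⟨hA0, hA⟩ := hA
  exact pow_le_div_of_bounds hκ.le hA0 hA (hprod.trans hG)

end Summit.CriticalPhenomena.Ising3DConformalLimit.Theorems.EvenPatternDecoupling
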